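import Literature.AlgebraicGeometry.HodgeTheory.QuaternionicQuarticDeckChart
import HarnessLib

/-!
# The double-plane chart of the quaternionic quartic multiple plane and its bridge to the étale deck chart
# (the `ℤ/4`-tower `ℙ² ← {w₁² = c·σc} ← V` read as ONE double cover `t² = s·α·ψ` of a rational surface)

Layer `Literature/AlgebraicGeometry/HodgeTheory`. Definitions + proved API (no named fact, nothing conditional). Written
by the prover seat `leafhand-hodge-q8symplecticpowers-4` (g4, cell `pub-hsemireg`) for route
`HodgeConjecture/Q8SymplecticPowers` (crux K1Q, stmt-HodgeConjecture-24190) as brick **Zb-3 «double-plane bridge»** of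
the programme behind the registered stub S1 `stub_regularVeryGeneralQ` («very generally `b₁ = 0`»; residue of record:
one fibre of the deck family with `b₁ = 0`, FIFTH-HAND-AUDIT lemma list Zb-1 … Zb-5) and of the Hodge-number counts
`(o)(o′)` of the member certificates LCERT₄ ∕ LCERT_{≥6} — both are classically computed on the DOUBLE-PLANE MODEL below.

## Mathematics

On the étale deck chart (`QuaternionicQuarticDeckChart`: `DeckRing a = R[u₀, u₁, w, w₁, w₂, v]/(r₁,…,r₇)`,
`w₁² = c·σc`, `w² = w₁·σc·α·ψ`, `v·h = 1`, `h = c·σc·α·ψ`) the reduced branch form `h` is a unit, so `σc` is a unit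
and one may pass to

  `s := w₁/σc`, `t := w/σc`  with  `c = s²·σc`, `t² = s·α·ψ`.

The **double-plane chart** is the `R`-algebra

  `DoublePlaneRing a = R[u₀, u₁, s, t] / (c − s²·σc, t² − s·α·ψ)`

(generators `X 0 = u₀, X 1 = u₁, X 2 = s, X 3 = t`; `c, σc, α = u₀ − u₁, ψ` dehomogenised at `x₂ = 1`). Its
spectrum is the double cover `t² = s·α·ψ` of the surface `Q⁺ = {c = s²·σc} ⊂ 𝔸³_{u₀,u₁,s}`, which is the chart
`σc ≠ 0 ∨ …` of the blow-up of the quadric cone `{w₁² = c·σc}` at its vertex — i.e. of the Hirzebruch surface `𝔽₂` —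
and is isomorphic to the `(s, σc)`-plane whenever the linear forms `c, σc` are independent (`(s, y) ↦` the unique
`(u₀, u₁)` with `c = s²y`, `σc = y`). In the coordinates `(s, y = σc)` the branch curve `s·α·ψ = 0` together with
`y = 0` (the exceptional curve `E`) and the fibres `s = 0, ±1, ∞` is the configuration `E + f₁ + … + f₄ + Ψ̃` of the
hands' census (Zariski 1929 ∕ Naie 2007: the irregularity of the desingularised double plane is a superabundance, here
`0`). This file provides the RING-LEVEL BRIDGE, with no genericity hypothesis on `a` and over any commutative ring `R`:

* `toDeck a : DoublePlaneRing a →ₐ[R] DeckRing a`, `u ↦ u`, `s ↦ w₁·(v c α ψ)`, `t ↦ w·(v c α ψ)` (`v c α ψ = 1/σc`);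
  well defined: `c − s²σc ↦ −(v²c²α²ψ²σc)·r₁ − c(vh + 1)·r₇`, `t² − sαψ ↦ (vcαψ)²·r₂ + w₁ v c α²ψ²·r₇`.
* `ofDeck a : DeckRing a →ₐ[R] Localization.Away h̄`, `h̄ =` the class of `h = c·σc·α·ψ` in `DoublePlaneRing a`:
  `u ↦ u`, `w ↦ t·σc`, `w₁ ↦ s·σc`, `w₂ ↦ t·s·σc`, `v ↦ 1/h̄`; well defined: `r₁ ↦ −σc·(c − s²σc)`,
  `r₂ ↦ σc²·(t² − sαψ)`, `r₃, r₆ ↦ s·σc²·(t² − sαψ) − (s)σc·αψ·(c − s²σc)` (up to the factor shown in the proofs),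
  `r₄ ↦ 0`, `r₅ ↦ −s·σc·(c − s²σc)`, `r₇ ↦ h̄·(1/h̄) − 1 = 0`.
* `isUnit_toDeck_hBar` : `toDeck h̄ = h` is a unit of the deck ring (inverse `v`), so `toDeck` extends to the
  localisation `(DoublePlaneRing a)_h̄`.

The sequel `QuaternionicQuarticDoublePlaneChartEquiv` proves that the two maps are mutually inverse after localising:
**`DeckRing a ≃+* Localization.Away h̄` — the étale deck chart IS the basic open `D(h)` of the double-plane chart** —
and rewrites the chart in the plane coordinates `(s, σc)`. Consequently (the consumers' business): `Spec (DeckRing a) → Spec (DoublePlaneRing a)` is an open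
immersion, so every surface of the route (a model of `V_(c,ψ)`, birational to the deck chart by
`QuaternionicQuarticDeckChartBirational`) is birational to the double plane `t² = s·α·ψ` over the `(s, σc)`-plane — the
shape in which S1's `q = 0` (Zariski ∕ Esnault–Viehweg ∕ Naie: `q = Σ_ξ h¹(ℙ², 𝓘_{Z(ξB)}(−3 + ξb))`) and the eigen-`h^{2,0}`
counts `(o)(o′)` are computed in print. Honest scope: explicit commutative algebra for one family of surfaces; nothing
here bears on HC, and S1 ∕ K1Q are NOT proved here.

## References

* [Kollar2007] J. Kollár, Lectures on Resolution of Singularities (2007), §3.3 (the family of multiple planes).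
* [Naie2007] D. Naie, The irregularity of cyclic multiple planes after Zariski, Enseign. Math. 53 (2007), §1.1–§1.2
  (standard cyclic coverings and the normalization procedure; Example 1: the Hirzebruch surface `𝔽ₙ` from the cone
  point) and Thm. 3.1 (irregularity as a sum of superabundances) [held: paper:arxiv-math_0603427].
* [EsnaultViehweg1982] H. Esnault, E. Viehweg, Revêtements cycliques, LNM 947 (1982), §3 (cyclic multiple planes,
  (3.11) irregularity via superabundance).
* [Zariski1929] O. Zariski, On the linear connection index of the algebraic surfaces zⁿ = f(x, y), Proc. Natl. Acad.
  Sci. USA 15 (1929) 494–501.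
* [Hartshorne1977] R. Hartshorne, Algebraic Geometry (1977), II Ex. 2.14, II Prop. 2.3 (b) (basic opens `D(h) = Spec A_h`).
-/

noncomputable section

open MvPolynomial

namespace Literature.AlgebraicGeometry.HodgeTheory.Q8Family

universe v

/-! ### The double-plane chart algebra -/

section Chart

variable {R : Type v} [CommRing R] {e : ℕ} (a : CIdx e → R)

/-- Dehomogenisation at `x₂ = 1` into the chart variables `u₀ = X 0`, `u₁ = X 1` of `R[u₀, u₁, s, t]`
(`= MvPolynomial (Fin 4) R`, indices `0, …, 3` in this order). [cite: Hartshorne1977, II Ex. 2.14] -/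
def dehom₄ : MvPolynomial (Fin 3) R →ₐ[R] MvPolynomial (Fin 4) R :=
  aeval ![X 0, X 1, 1]

/-- `c(u₀, u₁, 1)` in `R[u₀, u₁, s, t]`. [cite: Kollar2007, §3.3] -/
def c₄ : MvPolynomial (Fin 4) R := dehom₄ (cOfR a)

/-- `(σc)(u₀, u₁, 1)` in `R[u₀, u₁, s, t]`. [cite: Kollar2007, §3.3] -/
def c₄' : MvPolynomial (Fin 4) R := dehom₄ (rename (Equiv.swap (0 : Fin 3) 1) (cOfR a))

/-- `α = u₀ − u₁` in `R[u₀, u₁, s, t]`. [cite: Kollar2007, §3.3] -/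
def α₄ : MvPolynomial (Fin 4) R := X 0 - X 1

/-- `ψ(u₀, u₁, 1)` in `R[u₀, u₁, s, t]`. [cite: Kollar2007, §3.3] -/
def ψ₄ : MvPolynomial (Fin 4) R := dehom₄ (ψOfR a)

/-- The reduced branch form `h = c·σc·α·ψ` in `R[u₀, u₁, s, t]`. [cite: Kollar2007, §3.3] -/
def h₄ : MvPolynomial (Fin 4) R := c₄ a * c₄' a * α₄ * ψ₄ a

/-- The two relations of the double-plane chart: `c − s²·σc` (the rational surface `Q⁺`, a chart of `𝔽₂`) and
`t² − s·α·ψ` (the double cover). [cite: Naie2007, §1.2 (normalization procedure) and Example 1] -/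
def dpRel : Fin 2 → MvPolynomial (Fin 4) R
  | 0 => c₄ a - X 2 ^ 2 * c₄' a
  | 1 => X 3 ^ 2 - X 2 * α₄ * ψ₄ a

/-- The ideal `(c − s²σc, t² − sαψ)`. [cite: Naie2007, §1.2 (normalization procedure) and Example 1] -/
def dpIdeal : Ideal (MvPolynomial (Fin 4) R) := Ideal.span (Set.range (dpRel a))

/-- **The coordinate ring of the double-plane chart** `R[u₀, u₁, s, t]/(c − s²·σc, t² − s·α·ψ)`.
[cite: Naie2007, §1.2 (normalization procedure) and Example 1] [cite: Zariski1929] -/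
abbrev DoublePlaneRing : Type v := MvPolynomial (Fin 4) R ⧸ dpIdeal a

/-- Each relation lies in the ideal. [cite: Naie2007, §1.2 (normalization procedure) and Example 1] -/
theorem dpRel_mem_dpIdeal (k : Fin 2) : dpRel a k ∈ dpIdeal a := Ideal.subset_span ⟨k, rfl⟩

/-- A combination `u·(c − s²σc) + u'·(t² − sαψ)` lies in the ideal. [cite: Naie2007, §1.2 (normalization procedure) and Example 1] -/
theorem mem_dpIdeal_of_eq {p u u' : MvPolynomial (Fin 4) R} (h : p = u * dpRel a 0 + u' * dpRel a 1) :
    p ∈ dpIdeal a := by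
  rw [h]
  exact Ideal.add_mem _ (Ideal.mul_mem_left _ u (dpRel_mem_dpIdeal a 0))
    (Ideal.mul_mem_left _ u' (dpRel_mem_dpIdeal a 1))

/-- The class `h̄` of the reduced branch form in the double-plane chart ring (the element inverted on the deck
chart). [cite: Hartshorne1977, II Prop. 2.3 (b)] -/
def hBar : DoublePlaneRing a := Ideal.Quotient.mk (dpIdeal a) (h₄ a)

end Chart

/-! ### From the double-plane chart to the deck chart: `s ↦ w₁/σc`, `t ↦ w/σc` -/

section ToDeck

variable {R : Type v} [CommRing R] {e : ℕ} (a : CIdx e → R)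

/-- `1/σc = v·c·α·ψ` on the deck chart, as a polynomial. [cite: Kollar2007, §3.3] -/
def invC'U : MvPolynomial (Fin 6) R := X 5 * cU a * αU * ψU a

/-- The substitution `(u₀, u₁, s, t) ↦ (u₀, u₁, w₁·(v c α ψ), w·(v c α ψ))` on polynomial rings.
[cite: Naie2007, §1.2 (normalization procedure) and Example 1] -/
def toDeckPoly : MvPolynomial (Fin 4) R →ₐ[R] MvPolynomial (Fin 6) R :=
  aeval ![X 0, X 1, X 3 * invC'U a, X 2 * invC'U a]

/-- `toDeckPoly` on `u₀`. [cite: Naie2007, §1.2 (normalization procedure) and Example 1] -/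
@[simp] theorem toDeckPoly_X0 : toDeckPoly a (X 0) = X 0 := by simp [toDeckPoly]
/-- `toDeckPoly` on `u₁`. [cite: Naie2007, §1.2 (normalization procedure) and Example 1] -/
@[simp] theorem toDeckPoly_X1 : toDeckPoly a (X 1) = X 1 := by simp [toDeckPoly]
/-- `toDeckPoly` on `s`. [cite: Naie2007, §1.2 (normalization procedure) and Example 1] -/
@[simp] theorem toDeckPoly_X2 : toDeckPoly a (X 2) = X 3 * invC'U a := by simp [toDeckPoly]
/-- `toDeckPoly` on `t`. [cite: Naie2007, §1.2 (normalization procedure) and Example 1] -/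
@[simp] theorem toDeckPoly_X3 : toDeckPoly a (X 3) = X 2 * invC'U a := by simp [toDeckPoly]

/-- `toDeckPoly` is compatible with the two dehomogenisations (it fixes `u₀, u₁`). [cite: Hartshorne1977, II Ex. 2.14] -/
theorem toDeckPoly_dehom₄ (p : MvPolynomial (Fin 3) R) : toDeckPoly a (dehom₄ p) = dehom p := by
  change ((toDeckPoly a).comp dehom₄) p = dehom p
  congr 1
  refine MvPolynomial.algHom_ext fun i => ?_
  fin_cases i <;> simp [toDeckPoly, dehom₄, dehom]

/-- `c ↦ c`. [cite: Kollar2007, §3.3] -/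
@[simp] theorem toDeckPoly_c₄ : toDeckPoly a (c₄ a) = cU a := toDeckPoly_dehom₄ a _
/-- `σc ↦ σc`. [cite: Kollar2007, §3.3] -/
@[simp] theorem toDeckPoly_c₄' : toDeckPoly a (c₄' a) = cU' a := toDeckPoly_dehom₄ a _
/-- `ψ ↦ ψ`. [cite: Kollar2007, §3.3] -/
@[simp] theorem toDeckPoly_ψ₄ : toDeckPoly a (ψ₄ a) = ψU a := toDeckPoly_dehom₄ a _
/-- `α ↦ α`. [cite: Kollar2007, §3.3] -/
@[simp] theorem toDeckPoly_α₄ : toDeckPoly a (α₄ : MvPolynomial (Fin 4) R) = αU := by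
  simp only [α₄, map_sub, toDeckPoly_X0, toDeckPoly_X1, αU]
/-- `h ↦ h`. [cite: Kollar2007, §3.3] -/
@[simp] theorem toDeckPoly_h₄ : toDeckPoly a (h₄ a) = hU a := by
  simp only [h₄, map_mul, toDeckPoly_c₄, toDeckPoly_c₄', toDeckPoly_α₄, toDeckPoly_ψ₄, hU]

/-- A combination of two deck relations lies in the deck ideal. [folklore] -/
private theorem mem_deckIdeal_of_eq₂ {p u u' : MvPolynomial (Fin 6) R} (i j : Fin 7)
    (h : p = u * rel a i + u' * rel a j) : p ∈ deckIdeal a := by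
  rw [h]
  exact Ideal.add_mem _ (Ideal.mul_mem_left _ u (rel_mem_deckIdeal a i))
    (Ideal.mul_mem_left _ u' (rel_mem_deckIdeal a j))

/-- `toDeckPoly` maps both relations into the deck ideal:
`c − s²σc ↦ −(v²c²α²ψ²σc)·r₁ − c(vh + 1)·r₇` and `t² − sαψ ↦ (vcαψ)²·r₂ + w₁vcα²ψ²·r₇`. [cite: Naie2007, §1.2 (normalization procedure) and Example 1] -/
theorem toDeckPoly_dpRel_mem (k : Fin 2) : toDeckPoly a (dpRel a k) ∈ deckIdeal a := by
  fin_cases k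
  · refine mem_deckIdeal_of_eq₂ a 0 6 (u := -(invC'U a ^ 2 * cU' a)) (u' := -(cU a * (X 5 * hU a + 1))) ?_
    simp only [dpRel, map_sub, map_mul, map_pow, toDeckPoly_c₄, toDeckPoly_c₄', toDeckPoly_X2, rel, invC'U, hU]
    ring
  · refine mem_deckIdeal_of_eq₂ a 1 6 (u := invC'U a ^ 2) (u' := X 3 * X 5 * cU a * αU ^ 2 * ψU a ^ 2) ?_
    simp only [dpRel, map_sub, map_mul, map_pow, toDeckPoly_X3, toDeckPoly_X2, toDeckPoly_α₄, toDeckPoly_ψ₄, rel,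
      invC'U, hU]
    ring

/-- The double-plane ideal maps into the deck ideal. [cite: Naie2007, §1.2 (normalization procedure) and Example 1] -/
theorem dpIdeal_le_comap_toDeckPoly : dpIdeal a ≤ (deckIdeal a).comap (toDeckPoly a) := by
  rw [dpIdeal, Ideal.span_le]
  rintro _ ⟨k, rfl⟩
  exact toDeckPoly_dpRel_mem a k

/-- **The bridge map** `DoublePlaneRing a →ₐ[R] DeckRing a`, `s ↦ w₁/σc`, `t ↦ w/σc`. [cite: Naie2007, §1.2 (normalization procedure) and Example 1] -/
def toDeck : DoublePlaneRing a →ₐ[R] DeckRing a :=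
  Ideal.quotientMapₐ (deckIdeal a) (toDeckPoly a) (dpIdeal_le_comap_toDeckPoly a)

/-- `toDeck` on classes of polynomials. [cite: Naie2007, §1.2 (normalization procedure) and Example 1] -/
@[simp] theorem toDeck_mk (p : MvPolynomial (Fin 4) R) :
    toDeck a (Ideal.Quotient.mk (dpIdeal a) p) = Ideal.Quotient.mk (deckIdeal a) (toDeckPoly a p) := rfl

/-- `toDeck h̄ = h`, the inverted branch form of the deck chart. [cite: Kollar2007, §3.3] -/
theorem toDeck_hBar : toDeck a (hBar a) = Ideal.Quotient.mk (deckIdeal a) (hU a) := by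
  rw [hBar, toDeck_mk, toDeckPoly_h₄]

/-- `v·h = 1` in the deck ring. [cite: Kollar2007, §3.3] -/
theorem mk_X5_mul_mk_hU :
    Ideal.Quotient.mk (deckIdeal a) (X 5) * Ideal.Quotient.mk (deckIdeal a) (hU a) = 1 := by
  rw [← map_mul, ← (Ideal.Quotient.mk (deckIdeal a)).map_one, Ideal.Quotient.eq]
  exact Ideal.subset_span ⟨6, rfl⟩

/-- `toDeck h̄` is a unit of the deck ring (inverse `v`). [cite: Hartshorne1977, II Prop. 2.3 (b)] -/
theorem isUnit_toDeck_hBar : IsUnit (toDeck a (hBar a)) := by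
  rw [toDeck_hBar, isUnit_iff_exists_inv]
  exact ⟨Ideal.Quotient.mk (deckIdeal a) (X 5), by rw [mul_comm]; exact mk_X5_mul_mk_hU a⟩

end ToDeck

/-! ### From the deck chart to the localised double-plane chart: `w ↦ t·σc`, `w₁ ↦ s·σc`, `w₂ ↦ t·s·σc`, `v ↦ 1/h` -/

section OfDeck

variable {R : Type v} [CommRing R] {e : ℕ} (a : CIdx e → R)

/-- The localisation map `R[u₀, u₁, s, t] → DoublePlaneRing a → Localization.Away h̄` on polynomials.
[cite: Hartshorne1977, II Prop. 2.3 (b)] -/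
def awayMk : MvPolynomial (Fin 4) R →ₐ[R] Localization.Away (hBar a) :=
  (IsScalarTower.toAlgHom R (DoublePlaneRing a) (Localization.Away (hBar a))).comp
    (Ideal.Quotient.mkₐ R (dpIdeal a))

/-- `awayMk` is the composite of the quotient map and the localisation map. [cite: Hartshorne1977, II Prop. 2.3 (b)] -/
theorem awayMk_apply (p : MvPolynomial (Fin 4) R) :
    awayMk a p = algebraMap (DoublePlaneRing a) (Localization.Away (hBar a)) (Ideal.Quotient.mk (dpIdeal a) p) :=
  rfl

/-- `awayMk` kills the double-plane ideal. [cite: Hartshorne1977, II Prop. 2.3 (b)] -/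
theorem awayMk_eq_zero_of_mem {p : MvPolynomial (Fin 4) R} (hp : p ∈ dpIdeal a) : awayMk a p = 0 := by
  rw [awayMk_apply, Ideal.Quotient.eq_zero_iff_mem.mpr hp, map_zero]

/-- The substitution `(u₀, u₁, w, w₁, w₂, v) ↦ (u₀, u₁, t·σc, s·σc, t·s·σc, 1/h̄)` into the localised double-plane
chart ring. [cite: Naie2007, §1.2 (normalization procedure) and Example 1] -/
def ofDeckPoly : MvPolynomial (Fin 6) R →ₐ[R] Localization.Away (hBar a) :=
  aeval ![awayMk a (X 0), awayMk a (X 1), awayMk a (X 3 * c₄' a), awayMk a (X 2 * c₄' a),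
    awayMk a (X 3 * X 2 * c₄' a), IsLocalization.Away.invSelf (hBar a)]

/-- `ofDeckPoly` on `u₀`. [cite: Naie2007, §1.2 (normalization procedure) and Example 1] -/
@[simp] theorem ofDeckPoly_X0 : ofDeckPoly a (X 0) = awayMk a (X 0) := by simp [ofDeckPoly]
/-- `ofDeckPoly` on `u₁`. [cite: Naie2007, §1.2 (normalization procedure) and Example 1] -/
@[simp] theorem ofDeckPoly_X1 : ofDeckPoly a (X 1) = awayMk a (X 1) := by simp [ofDeckPoly]
/-- `ofDeckPoly` on `w`. [cite: Naie2007, §1.2 (normalization procedure) and Example 1] -/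
@[simp] theorem ofDeckPoly_X2 : ofDeckPoly a (X 2) = awayMk a (X 3 * c₄' a) := by simp [ofDeckPoly]
/-- `ofDeckPoly` on `w₁`. [cite: Naie2007, §1.2 (normalization procedure) and Example 1] -/
@[simp] theorem ofDeckPoly_X3 : ofDeckPoly a (X 3) = awayMk a (X 2 * c₄' a) := by simp [ofDeckPoly]
/-- `ofDeckPoly` on `w₂`. [cite: Naie2007, §1.2 (normalization procedure) and Example 1] -/
@[simp] theorem ofDeckPoly_X4 : ofDeckPoly a (X 4) = awayMk a (X 3 * X 2 * c₄' a) := by simp [ofDeckPoly]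
/-- `ofDeckPoly` on `v`. [cite: Naie2007, §1.2 (normalization procedure) and Example 1] -/
@[simp] theorem ofDeckPoly_X5 : ofDeckPoly a (X 5) = IsLocalization.Away.invSelf (hBar a) := by
  simp [ofDeckPoly]

/-- `ofDeckPoly` is compatible with the two dehomogenisations (it fixes `u₀, u₁`). [cite: Hartshorne1977, II Ex. 2.14] -/
theorem ofDeckPoly_dehom (p : MvPolynomial (Fin 3) R) : ofDeckPoly a (dehom p) = awayMk a (dehom₄ p) := by
  change ((ofDeckPoly a).comp dehom) p = ((awayMk a).comp dehom₄) p
  congr 1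
  refine MvPolynomial.algHom_ext fun i => ?_
  fin_cases i <;> simp [ofDeckPoly, dehom₄, dehom]

/-- `c ↦ c`. [cite: Kollar2007, §3.3] -/
@[simp] theorem ofDeckPoly_cU : ofDeckPoly a (cU a) = awayMk a (c₄ a) := ofDeckPoly_dehom a _
/-- `σc ↦ σc`. [cite: Kollar2007, §3.3] -/
@[simp] theorem ofDeckPoly_cU' : ofDeckPoly a (cU' a) = awayMk a (c₄' a) := ofDeckPoly_dehom a _
/-- `ψ ↦ ψ`. [cite: Kollar2007, §3.3] -/
@[simp] theorem ofDeckPoly_ψU : ofDeckPoly a (ψU a) = awayMk a (ψ₄ a) := ofDeckPoly_dehom a _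
/-- `α ↦ α`. [cite: Kollar2007, §3.3] -/
@[simp] theorem ofDeckPoly_αU : ofDeckPoly a (αU : MvPolynomial (Fin 6) R) = awayMk a α₄ := by
  simp only [αU, map_sub, ofDeckPoly_X0, ofDeckPoly_X1, α₄]
/-- `h ↦ h̄`. [cite: Kollar2007, §3.3] -/
@[simp] theorem ofDeckPoly_hU : ofDeckPoly a (hU a) = awayMk a (h₄ a) := by
  simp only [hU, map_mul, ofDeckPoly_cU, ofDeckPoly_cU', ofDeckPoly_αU, ofDeckPoly_ψU, h₄]

/-- `h̄ · (1/h̄) = 1` in the localisation. [cite: Hartshorne1977, II Prop. 2.3 (b)] -/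
theorem awayMk_h₄_mul_invSelf : awayMk a (h₄ a) * IsLocalization.Away.invSelf (hBar a) = 1 :=
  IsLocalization.Away.mul_invSelf (hBar a)

/-- `r₁ ↦ −σc·(c − s²σc)`. [cite: Naie2007, §1.2 (normalization procedure) and Example 1] -/
private theorem ofDeckPoly_rel0 : ofDeckPoly a (rel a 0) = 0 := by
  have h : ofDeckPoly a (rel a 0) = awayMk a (-c₄' a * dpRel a 0 + 0 * dpRel a 1) := by
    simp only [rel, dpRel, map_sub, map_mul, map_pow, map_add, map_neg, map_zero]
    simp only [ofDeckPoly_X3, ofDeckPoly_cU, ofDeckPoly_cU', map_mul]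
    ring
  rw [h]
  exact awayMk_eq_zero_of_mem a (mem_dpIdeal_of_eq a rfl)

/-- `r₂ ↦ σc²·(t² − sαψ)`. [cite: Naie2007, §1.2 (normalization procedure) and Example 1] -/
private theorem ofDeckPoly_rel1 : ofDeckPoly a (rel a 1) = 0 := by
  have h : ofDeckPoly a (rel a 1) = awayMk a (0 * dpRel a 0 + c₄' a ^ 2 * dpRel a 1) := by
    simp only [rel, dpRel, map_sub, map_mul, map_pow, map_add, map_zero]
    simp only [ofDeckPoly_X2, ofDeckPoly_X3, ofDeckPoly_cU', ofDeckPoly_αU, ofDeckPoly_ψU, map_mul]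
    ring
  rw [h]
  exact awayMk_eq_zero_of_mem a (mem_dpIdeal_of_eq a rfl)

/-- `r₃ ↦ s²σc²·(t² − sαψ) − sσc·αψ·(c − s²σc)`. [cite: Naie2007, §1.2 (normalization procedure) and Example 1] -/
private theorem ofDeckPoly_rel2 : ofDeckPoly a (rel a 2) = 0 := by
  have h : ofDeckPoly a (rel a 2) =
      awayMk a (-(X 2 * c₄' a * α₄ * ψ₄ a) * dpRel a 0 + (X 2 ^ 2 * c₄' a ^ 2) * dpRel a 1) := by
    simp only [rel, dpRel, map_sub, map_mul, map_pow, map_add, map_neg]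
    simp only [ofDeckPoly_X4, ofDeckPoly_X3, ofDeckPoly_cU, ofDeckPoly_αU, ofDeckPoly_ψU, map_mul]
    ring
  rw [h]
  exact awayMk_eq_zero_of_mem a (mem_dpIdeal_of_eq a rfl)

/-- `r₄ ↦ 0`. [cite: Naie2007, §1.2 (normalization procedure) and Example 1] -/
private theorem ofDeckPoly_rel3 : ofDeckPoly a (rel a 3) = 0 := by
  have h : ofDeckPoly a (rel a 3) = awayMk a (0 * dpRel a 0 + 0 * dpRel a 1) := by
    simp only [rel, dpRel, map_sub, map_mul, map_add, map_zero]
    simp only [ofDeckPoly_X2, ofDeckPoly_X3, ofDeckPoly_X4, ofDeckPoly_cU', map_mul]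
    ring
  rw [h]
  exact awayMk_eq_zero_of_mem a (mem_dpIdeal_of_eq a rfl)

/-- `r₅ ↦ −sσc·(c − s²σc)`. [cite: Naie2007, §1.2 (normalization procedure) and Example 1] -/
private theorem ofDeckPoly_rel4 : ofDeckPoly a (rel a 4) = 0 := by
  have h : ofDeckPoly a (rel a 4) = awayMk a (-(X 3 * c₄' a) * dpRel a 0 + 0 * dpRel a 1) := by
    simp only [rel, dpRel, map_sub, map_mul, map_pow, map_add, map_neg, map_zero]
    simp only [ofDeckPoly_X3, ofDeckPoly_X4, ofDeckPoly_X2, ofDeckPoly_cU, map_mul]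
    ring
  rw [h]
  exact awayMk_eq_zero_of_mem a (mem_dpIdeal_of_eq a rfl)

/-- `r₆ ↦ sσc²·(t² − sαψ) − σc·αψ·(c − s²σc)`. [cite: Naie2007, §1.2 (normalization procedure) and Example 1] -/
private theorem ofDeckPoly_rel5 : ofDeckPoly a (rel a 5) = 0 := by
  have h : ofDeckPoly a (rel a 5) =
      awayMk a (-(c₄' a * α₄ * ψ₄ a) * dpRel a 0 + (X 2 * c₄' a ^ 2) * dpRel a 1) := by
    simp only [rel, dpRel, map_sub, map_mul, map_pow, map_add, map_neg]
    simp only [ofDeckPoly_X2, ofDeckPoly_X4, ofDeckPoly_hU, h₄, map_mul]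
    ring
  rw [h]
  exact awayMk_eq_zero_of_mem a (mem_dpIdeal_of_eq a rfl)

/-- `r₇ ↦ h̄·(1/h̄) − 1 = 0`. [cite: Hartshorne1977, II Prop. 2.3 (b)] -/
private theorem ofDeckPoly_rel6 : ofDeckPoly a (rel a 6) = 0 := by
  simp only [rel, map_sub, map_mul, map_one, ofDeckPoly_X5, ofDeckPoly_hU]
  rw [mul_comm, awayMk_h₄_mul_invSelf, sub_self]

/-- `ofDeckPoly` kills every deck relation: `r₁ ↦ −σc·(c − s²σc)`, `r₂ ↦ σc²·(t² − sαψ)`,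
`r₃ ↦ s²σc²·(t² − sαψ) − sσc·αψ·(c − s²σc)`, `r₄ ↦ 0`, `r₅ ↦ −sσc·(c − s²σc)`,
`r₆ ↦ sσc²·(t² − sαψ) − σc·αψ·(c − s²σc)`, `r₇ ↦ h̄/h̄ − 1 = 0`. [cite: Naie2007, §1.2 (normalization procedure) and Example 1] -/
theorem ofDeckPoly_rel (k : Fin 7) : ofDeckPoly a (rel a k) = 0 := by
  fin_cases k
  exacts [ofDeckPoly_rel0 a, ofDeckPoly_rel1 a, ofDeckPoly_rel2 a, ofDeckPoly_rel3 a, ofDeckPoly_rel4 a,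
    ofDeckPoly_rel5 a, ofDeckPoly_rel6 a]

/-- `ofDeckPoly` kills the deck ideal. [cite: Naie2007, §1.2 (normalization procedure) and Example 1] -/
theorem ofDeckPoly_eq_zero_of_mem {p : MvPolynomial (Fin 6) R} (hp : p ∈ deckIdeal a) : ofDeckPoly a p = 0 := by
  have h : deckIdeal a ≤ RingHom.ker (ofDeckPoly a).toRingHom := by
    rw [deckIdeal, Ideal.span_le]
    rintro _ ⟨k, rfl⟩
    exact ofDeckPoly_rel a k
  exact h hp

/-- **The inverse bridge map** `DeckRing a →ₐ[R] Localization.Away h̄`, `w ↦ t·σc`, `w₁ ↦ s·σc`, `w₂ ↦ t·s·σc`,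
`v ↦ 1/h̄`. [cite: Naie2007, §1.2 (normalization procedure) and Example 1] [cite: Hartshorne1977, II Prop. 2.3 (b)] -/
def ofDeck : DeckRing a →ₐ[R] Localization.Away (hBar a) :=
  Ideal.Quotient.liftₐ (deckIdeal a) (ofDeckPoly a) (fun _ hp => ofDeckPoly_eq_zero_of_mem a hp)

/-- `ofDeck` on classes of polynomials. [cite: Naie2007, §1.2 (normalization procedure) and Example 1] -/
@[simp] theorem ofDeck_mk (p : MvPolynomial (Fin 6) R) :
    ofDeck a (Ideal.Quotient.mk (deckIdeal a) p) = ofDeckPoly a p := rfl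

end OfDeck

end Literature.AlgebraicGeometry.HodgeTheory.Q8Family

end
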